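import Summits.NavierStokesRegularity.NavierStokesRegularity.Theorems.SqueezeCycleSingularProfileOfNontrivialMorreyDuality

/-!
# Route SqueezeCycle · item `SingularProfileOfNontrivial` (stmt-NavierStokesRegularity-15368):
# the pressure of a classical solution with MORREY slices is the Riesz pressure (`∇p = ∇Q[u(t)]`)

Helper file (theorems only): Tao's pressure normalisation (Tao 2011, Lemma 4.1 (i)) for classical
solutions of the unforced Navier–Stokes system on `[0, T]` whose slices obey the scale-invariant Morrey
bound `∫_{B(x,r)} |u(t)|² ≤ A r` (`r ≥ 1`) — infinite energy, no pointwise decay. Verbatim the decay-class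
`PineauVicolPressureIdentification.lean` with the Morrey-class potential (`…MorreyPotential`) and probe
bounds (`…ProbeBounds`, `…MorreyDuality`): `h(t) = p(t) − Q[u(t)]` is harmonic, the probe identity,
`∇h(t) = 0` by the real-variable uniqueness lemma of `HarmonicProbe`, and `h(t)` is constant in space.

References: T. Tao, Anal. PDE 6 (2013), §4, proof of Lemma 4.1 (i) [Tao2011]; D. Albritton, T. Barker,
J. Math. Fluid Mech. 21 (2019) = arXiv:1811.00502, §1, §3 [AlbrittonBarker2019]; G. Koch, N. Nadirashvili,
G. Seregin, V. Šverák, Acta Math. 203 (2009) [KochNadirashviliSereginSverak2009].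
-/

noncomputable section

-- the sub-problem namespace repeats the summit name (D-0017 layout `Summit.<S>.<P>.Theorems`)
set_option linter.dupNamespace false
-- nested operator types `ℝ³ →L[ℝ] ℝ³ →L[ℝ] ℝ³ →L[ℝ] ℝ` (pressure kernels)
set_option maxSynthPendingDepth 3

namespace Summit.NavierStokesRegularity.NavierStokesRegularity.Theorems.SingularProfile

open MeasureTheory Set Filter Metric Function
open _root_.Topology
open scoped ENNReal NNReal Laplacian ContDiff RealInnerProductSpace
open Literature.Analysis.FluidPDE
open Literature.Analysis.FluidPDE.FourierNS (HasDecay)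

variable {ν T : ℝ} {u : ℝ → (EuclideanSpace ℝ (Fin 3)) → (EuclideanSpace ℝ (Fin 3))}
  {p : ℝ → (EuclideanSpace ℝ (Fin 3)) → ℝ}

/-- For a classical solution of the unforced system whose slice at an interior time obeys the
Morrey bound `∫_{B(x,r)}|u(t)|² ≤ A r` (`r ≥ 1`; infinite energy, no decay), the harmonic part
`h(t) = p(t) − Q[u(t)]` of the pressure is harmonic on `ℝ³` (as the finite-energy
`harmonicOnNhd_pressure_sub_pressurePotential`, with `laplacian_pressurePotential_morrey`).
[cite: Tao2011, §4, proof of Lemma 4.1 (i)] -/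
theorem harmonicOnNhd_pressure_sub_pressurePotential_morrey
    (h : IsClassicalNSSolutionOn (Icc 0 T) ν 0 u p) {t : ℝ} (ht : t ∈ Ioo 0 T) {A : ℝ}
    (hA : ∀ (x : EuclideanSpace ℝ (Fin 3)) (r : ℝ), 1 ≤ r → ∫ y in ball x r, ‖u t y‖ ^ 2 ≤ A * r) :
    InnerProductSpace.HarmonicOnNhd (fun x => p t x - pressurePotential (u t) x) univ := by
  have htI : t ∈ Icc 0 T := Ioo_subset_Icc_self ht
  have hu : ContDiff ℝ ∞ (u t) := h.contDiff_velocity htI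
  have hp : ContDiff ℝ ∞ (p t) := h.contDiff_pressure htI
  have hu4 : ContDiff ℝ 4 (u t) := contDiff_infty.1 hu 4
  have hp2 : ContDiff ℝ 2 (p t) := contDiff_infty.1 hp 2
  have hQ2 : ContDiff ℝ 2 (pressurePotential (u t)) := contDiff_pressurePotential_morrey hu4 hA
  have hη2 : ContDiff ℝ 2 fun x => p t x - pressurePotential (u t) x := hp2.sub hQ2
  have hti : t ∈ interior (Icc 0 T) := by rwa [interior_Icc]
  have hΔ : ∀ x, Δ (fun x => p t x - pressurePotential (u t) x) x = 0 := fun x => by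
    have e : (fun x => p t x - pressurePotential (u t) x) = p t - pressurePotential (u t) := rfl
    rw [e, hp2.contDiffAt.laplacian_sub hQ2.contDiffAt, laplacian_pressurePotential_morrey hu4 hA x,
      laplacian_pressure_eq_of_isClassicalNSSolutionOn h hti x,
      pressureSource_eq_of_isDivFree (h.divFree t htI)]
    have : VectorCalculus.divergence ((0 : ℝ → (EuclideanSpace ℝ (Fin 3)) →
        (EuclideanSpace ℝ (Fin 3))) t) x = 0 := by
      simp [VectorCalculus.divergence]
    rw [this]
    ring
  intro x _
  exact ⟨hη2.contDiffAt, Eventually.of_forall hΔ⟩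

/-- **The probe identity on the Morrey class** (verbatim the finite-energy
`fderiv_harmonicPart_eq`, whose only uses of the energy are the `C²` regularity of `Q[u(t)]`
and the harmonicity of `h(t)`, here supplied by the Morrey-class lemmas):
`∂ₐh(t, x₀) = ν ∫ ⟪u, Δφ a⟫ + ∫ ⟪u, (u·∇φ) a⟫ - ∫ ⟪∂ₜu, φ a⟫ - ∫ ∂ₐχ_R(z) Q[u(t)](x₀ - z) dz`,
`φ = χ_R(· − x₀)`. [cite: Tao2011, §4, proof of Lemma 4.1 (i)] -/
theorem fderiv_harmonicPart_eq_morrey (h : IsClassicalNSSolutionOn (Icc 0 T) ν 0 u p) {t : ℝ}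
    (ht : t ∈ Ioo 0 T) {A : ℝ}
    (hA : ∀ (x : EuclideanSpace ℝ (Fin 3)) (r : ℝ), 1 ≤ r → ∫ y in ball x r, ‖u t y‖ ^ 2 ≤ A * r)
    {R : ℝ} (hR : 0 < R) (x₀ a : EuclideanSpace ℝ (Fin 3)) :
    fderiv ℝ (fun x => p t x - pressurePotential (u t) x) x₀ a =
      ν * (∫ y, ⟪u t y, (Δ (fun y => probeBump R (y - x₀))) y • a⟫)
      + (∫ y, ⟪u t y, fderiv ℝ (fun y => probeBump R (y - x₀)) y (u t y) • a⟫)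
      - (∫ y, ⟪timeDerivWithin (Icc 0 T) u t y, probeBump R (y - x₀) • a⟫)
      - ∫ z, fderiv ℝ (probeBump R) z a * pressurePotential (u t) (x₀ - z) := by
  haveI : CompleteSpace (EuclideanSpace ℝ (Fin 3)) := inferInstance
  have hT : 0 < T := ht.1.trans ht.2
  have hS : UniqueDiffOn ℝ (Icc 0 T) := uniqueDiffOn_Icc hT
  have htI : t ∈ Icc 0 T := Ioo_subset_Icc_self ht
  -- regularity of the slices
  have hu : ContDiff ℝ ∞ (u t) := h.contDiff_velocity htI
  have hp : ContDiff ℝ ∞ (p t) := h.contDiff_pressure htI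
  have hu4 : ContDiff ℝ 4 (u t) := contDiff_infty.1 hu 4
  have hu2 : ContDiff ℝ 2 (u t) := contDiff_infty.1 hu 2
  have hu1 : ContDiff ℝ 1 (u t) := contDiff_infty.1 hu 1
  have hp1 : ContDiff ℝ 1 (p t) := contDiff_infty.1 hp 1
  have huc : Continuous (u t) := hu.continuous
  set Q := pressurePotential (u t) with hQ_def
  have hQ2 : ContDiff ℝ 2 Q := contDiff_pressurePotential_morrey hu4 hA
  have hQc : Continuous Q := hQ2.continuous
  have hη := harmonicOnNhd_pressure_sub_pressurePotential_morrey h ht hA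
  -- the bump, its translate and the vector test field
  set χ : (EuclideanSpace ℝ (Fin 3)) → ℝ := probeBump R with hχ_def
  have hχs : ContDiff ℝ ∞ χ := contDiff_probeBump R
  have hχ1 : ContDiff ℝ 1 χ := contDiff_infty.1 hχs 1
  have hχc : HasCompactSupport χ := hasCompactSupport_probeBump hR
  set φ : (EuclideanSpace ℝ (Fin 3)) → ℝ := fun y => χ (y - x₀) with hφ_def
  have hφs : ContDiff ℝ ∞ φ := hχs.comp (contDiff_id.sub contDiff_const)
  have hφ2 : ContDiff ℝ 2 φ := contDiff_infty.1 hφs 2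
  have hφ1 : ContDiff ℝ 1 φ := contDiff_infty.1 hφs 1
  have hφc : HasCompactSupport φ := by
    have e : φ = χ ∘ Homeomorph.addRight (-x₀) := by
      funext y; simp [hφ_def, sub_eq_add_neg]
    rw [e]
    exact hχc.comp_homeomorph _
  have hφχ : ∀ y, χ (x₀ - y) = φ y := fun y => by
    simp only [hφ_def, hχ_def]
    rw [← probeBump_neg R (y - x₀), neg_sub]
  set Ψ : (EuclideanSpace ℝ (Fin 3)) → (EuclideanSpace ℝ (Fin 3)) := fun y => φ y • a with hΨ_def
  have hΨ2 : ContDiff ℝ 2 Ψ := hφ2.smul contDiff_const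
  have hΨ1 : ContDiff ℝ 1 Ψ := hφ1.smul contDiff_const
  have hΨc : HasCompactSupport Ψ := hφc.smul_right (f' := fun _ => a)
  have hΨcont : Continuous Ψ := hΨ1.continuous
  -- derivatives of the test field
  have hDΨ : ∀ y w, fderiv ℝ Ψ y w = (fderiv ℝ φ y w) • a := fun y w => by
    simp only [hΨ_def]
    rw [fderiv_smul_const (hφ1.differentiable one_ne_zero y), ContinuousLinearMap.smulRight_apply]
  have hΔΨ : ∀ y, (Δ Ψ) y = (Δ φ) y • a := fun y => by
    have e : Ψ = (ContinuousLinearMap.toSpanSingleton ℝ a) ∘ φ := by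
      funext w; simp [hΨ_def, ContinuousLinearMap.toSpanSingleton_apply]
    rw [e, hφ2.contDiffAt.laplacian_CLM_comp_left]
    simp [ContinuousLinearMap.toSpanSingleton_apply]
  -- continuity of the slices entering the momentum equation
  have hΔuc : Continuous (Δ (u t)) := Literature.Analysis.FluidPDE.continuous_laplacian hu2
  have hdtc : Continuous (timeDerivWithin (Icc 0 T) u t) :=
    ((h.smooth_velocity.timeDerivWithin hS).contDiff_slice htI).continuous
  have hcvc : Continuous (convect (u t) (u t)) :=
    (hu1.continuous_fderiv one_ne_zero).clm_apply huc
  -- Step 1: the mean-value formula for the gradient of the harmonic part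
  rw [fderiv_harmonic_eq_integral_probeBump hη hR x₀ a]
  -- Step 2: split into the pressure and the potential parts
  have hDχc : Continuous fun z => fderiv ℝ χ z a :=
    (hχ1.continuous_fderiv one_ne_zero).clm_apply continuous_const
  have hDχs : HasCompactSupport fun z => fderiv ℝ χ z a := hχc.fderiv_apply (𝕜 := ℝ) a
  have iP : Integrable fun z => fderiv ℝ χ z a * p t (x₀ - z) :=
    (hDχc.mul (hp.continuous.comp (continuous_const.sub continuous_id))).integrable_of_hasCompactSupport
      hDχs.mul_right
  have iQ : Integrable fun z => fderiv ℝ χ z a * Q (x₀ - z) :=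
    (hDχc.mul (hQc.comp (continuous_const.sub continuous_id))).integrable_of_hasCompactSupport
      hDχs.mul_right
  have e2 : ∫ z, fderiv ℝ χ z a * (p t (x₀ - z) - Q (x₀ - z)) =
      (∫ z, fderiv ℝ χ z a * p t (x₀ - z)) - ∫ z, fderiv ℝ χ z a * Q (x₀ - z) := by
    rw [← integral_sub iP iQ]
    refine integral_congr_ae (Eventually.of_forall fun z => ?_)
    simp only [mul_sub]
  rw [e2]
  -- Step 3: the pressure part through the momentum equation
  have iL := Literature.Analysis.FluidPDE.integrable_inner_of_hasCompactSupport_right hΔuc hΨcont hΨc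
  have iT := Literature.Analysis.FluidPDE.integrable_inner_of_hasCompactSupport_right hdtc hΨcont hΨc
  have iC := Literature.Analysis.FluidPDE.integrable_inner_of_hasCompactSupport_right hcvc hΨcont hΨc
  have e3 : ∫ z, fderiv ℝ χ z a * p t (x₀ - z) = ∫ y, ⟪gradient (p t) y, Ψ y⟫ := by
    rw [integral_fderiv_mul_comp_sub hχ1 hχc hp1 x₀ a,
      ← integral_sub_left_eq_self (fun z => χ z * fderiv ℝ (p t) (x₀ - z) a) volume x₀]
    have hg : ∀ y, ⟪gradient (p t) y, a⟫ = fderiv ℝ (p t) y a := fun y => by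
      rw [← Literature.Analysis.FluidPDE.inner_gradient_eq_fderiv_apply, real_inner_comm]
    refine integral_congr_ae (Eventually.of_forall fun y => ?_)
    simp only [sub_sub_cancel, hΨ_def, inner_smul_right, hg, hφχ y]
  have e4 : ∫ y, ⟪gradient (p t) y, Ψ y⟫ =
      ν * (∫ y, ⟪(Δ (u t)) y, Ψ y⟫) - (∫ y, ⟪timeDerivWithin (Icc 0 T) u t y, Ψ y⟫) -
        ∫ y, ⟪convect (u t) (u t) y, Ψ y⟫ := by
    have key : ∀ y, ⟪gradient (p t) y, Ψ y⟫ = ν * ⟪(Δ (u t)) y, Ψ y⟫ -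
        ⟪timeDerivWithin (Icc 0 T) u t y, Ψ y⟫ - ⟪convect (u t) (u t) y, Ψ y⟫ := by
      intro y
      rw [gradient_pressure_eq h htI y, inner_sub_left, inner_sub_left, inner_smul_left]
      simp
    have i2 : Integrable fun y => ν * ⟪(Δ (u t)) y, Ψ y⟫ := iL.const_mul ν
    have i1 : Integrable fun y => ν * ⟪(Δ (u t)) y, Ψ y⟫ -
        ⟪timeDerivWithin (Icc 0 T) u t y, Ψ y⟫ := i2.sub iT
    rw [integral_congr_ae (Eventually.of_forall key), integral_sub i1 iC, integral_sub i2 iT,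
      integral_const_mul]
  -- Green's identity for the viscous term
  have e5 : ∫ y, ⟪(Δ (u t)) y, Ψ y⟫ = ∫ y, ⟪u t y, (Δ φ) y • a⟫ := by
    rw [Literature.Analysis.FluidPDE.integral_inner_laplacian_comm hu2 hΨ2 hΨc]
    exact integral_congr_ae (Eventually.of_forall fun y => by
      show ⟪u t y, (Δ Ψ) y⟫ = ⟪u t y, (Δ φ) y • a⟫
      rw [hΔΨ y])
  -- the trilinear identity for the transport term
  have e6 : ∫ y, ⟪convect (u t) (u t) y, Ψ y⟫ =
      -∫ y, ⟪u t y, fderiv ℝ φ y (u t y) • a⟫ := by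
    have h0 := Literature.Analysis.FluidPDE.integral_inner_convect_add_eq_zero hu1 hu1 hΨ1 hΨc
    have hz : ∫ y, VectorCalculus.divergence (u t) y * ⟪u t y, Ψ y⟫ = 0 := by
      simp [h.divFree t htI _]
    have hc : ∫ y, ⟪u t y, convect (u t) Ψ y⟫ = ∫ y, ⟪u t y, fderiv ℝ φ y (u t y) • a⟫ :=
      integral_congr_ae (Eventually.of_forall fun y => by simp only [convect, hDΨ])
    linarith
  rw [e3, e4, e5, e6]
  ring

/-- **`∇h(t) = 0` at interior times for the Morrey class** (Tao 2011, §4, proof of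
Lemma 4.1 (i), conclusion, with the energy replaced by the Morrey constant): for a classical
solution of the unforced system on `[0, T]` with `∫_{B(x,r)}|u(t)|² ≤ A r` (`r ≥ 1`) for all
`t ∈ [0,T]`, the harmonic part `h(t) = p(t) − Q[u(t)]` has vanishing derivative at every point,
for every `t ∈ (0, T)`: the probe identity gives `∂ₐh(t,x₀) = −W_R'(t) + O((1 + A)/R)` with
`|W_R| = O((1+A)/R)` uniformly in `t` (constants depending on `x₀`, `a`), and the real-variable
uniqueness lemma of `HarmonicProbe` concludes. [cite: Tao2011, §4, proof of Lemma 4.1 (i)] -/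
theorem fderiv_harmonicPart_eq_zero_morrey (hν : 0 ≤ ν)
    (h : IsClassicalNSSolutionOn (Icc 0 T) ν 0 u p) {A : ℝ} (hA0 : 0 ≤ A)
    (hA : ∀ t ∈ Icc 0 T, ∀ (x : EuclideanSpace ℝ (Fin 3)) (r : ℝ), 1 ≤ r →
      ∫ y in ball x r, ‖u t y‖ ^ 2 ≤ A * r)
    (x₀ a : EuclideanSpace ℝ (Fin 3)) :
    ∀ t ∈ Ioo 0 T, fderiv ℝ (fun x => p t x - pressurePotential (u t) x) x₀ a = 0 := by
  -- the constants of the four probe bounds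
  obtain ⟨K₁, hK₁0, hK₁⟩ := exists_bound_probe_laplacian_morrey a x₀
  obtain ⟨K₂, hK₂0, hK₂⟩ := exists_bound_probe_transport_morrey a x₀
  obtain ⟨K₃, hK₃0, hK₃⟩ := exists_bound_probe_boundary_morrey a x₀
  obtain ⟨K₄, hK₄0, hK₄⟩ := exists_bound_probe_potential_morrey a
  set D : ℝ := 1 + A with hD
  have hD0 : 0 ≤ D := by positivity
  have hAD : A ≤ D := by rw [hD]; linarith
  obtain ⟨K, hK⟩ : ∃ K : ℝ, K = (ν * K₁ + K₂ + K₃ + K₄) * D := ⟨_, rfl⟩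
  have hνK : 0 ≤ ν * K₁ := mul_nonneg hν hK₁0
  have hK3le : K₃ * D ≤ K := by
    rw [hK]
    exact mul_le_mul_of_nonneg_right (by linarith) hD0
  have hK124le : (ν * K₁ + K₂ + K₄) * D ≤ K := by
    rw [hK]
    exact mul_le_mul_of_nonneg_right (by linarith) hD0
  refine eq_zero_of_approx_antiderivative fun ε hε => ?_
  -- vacuous unless `0 < T`
  by_cases hT : 0 < T
  swap
  · exact ⟨0, 0, continuousOn_const, fun t ht => absurd (ht.1.trans ht.2) hT,
      fun t ht => absurd (ht.1.trans ht.2) hT, fun t ht => absurd (ht.1.trans ht.2) hT⟩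
  -- the scale `R ≥ 1` with `K/R ≤ ε`
  obtain ⟨R, hR⟩ : ∃ R : ℝ, R = max 1 (K / ε) := ⟨_, rfl⟩
  have hR1 : 1 ≤ R := by rw [hR]; exact le_max_left _ _
  have hR0 : 0 < R := one_pos.trans_le hR1
  have hRi : 0 ≤ R⁻¹ := inv_nonneg.2 hR0.le
  have hKR : K * R⁻¹ ≤ ε := by
    rw [← div_eq_mul_inv, div_le_iff₀ hR0]
    calc K = K / ε * ε := by field_simp
      _ ≤ R * ε := by gcongr; rw [hR]; exact le_max_right _ _
      _ = ε * R := mul_comm _ _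
  -- the test field and the boundary term
  have hΨs : ContDiff ℝ ∞ fun y : EuclideanSpace ℝ (Fin 3) => probeBump R (y - x₀) • a :=
    ((contDiff_probeBump (E := EuclideanSpace ℝ (Fin 3)) R).comp (contDiff_id.sub contDiff_const)).smul
      contDiff_const
  have hΨc : HasCompactSupport fun y : EuclideanSpace ℝ (Fin 3) => probeBump R (y - x₀) • a := by
    have h1 : HasCompactSupport fun y : EuclideanSpace ℝ (Fin 3) => probeBump R (y - x₀) := by
      have e : (fun y : EuclideanSpace ℝ (Fin 3) => probeBump R (y - x₀)) =
          probeBump R ∘ Homeomorph.addRight (-x₀) := by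
        funext y; simp [sub_eq_add_neg]
      rw [e]
      exact (hasCompactSupport_probeBump hR0).comp_homeomorph _
    exact h1.smul_right (f' := fun _ => a)
  refine ⟨fun s => ∫ y, ⟪u s y, probeBump R (y - x₀) • a⟫,
    fun s => ∫ y, ⟪timeDerivWithin (Icc 0 T) u s y, probeBump R (y - x₀) • a⟫,
    (continuousOn_integral_inner_timeDerivWithin hT h hΨs.continuous hΨc).mono Ioo_subset_Icc_self,
    fun t ht => hasDerivAt_integral_inner_velocity h hΨs hΨc ht, fun t ht => ?_, fun t ht => ?_⟩
  · -- `|W| ≤ ε`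
    have htI : t ∈ Icc 0 T := Ioo_subset_Icc_self ht
    have hb := hK₃ (u t) A (h.contDiff_velocity htI).continuous (hA t htI) R hR1
    calc |∫ y, ⟪u t y, probeBump R (y - x₀) • a⟫| ≤ K₃ * (1 + A) * R⁻¹ := hb
      _ = K₃ * D * R⁻¹ := by rw [hD]
      _ ≤ K * R⁻¹ := mul_le_mul_of_nonneg_right hK3le hRi
      _ ≤ ε := hKR
  · -- `|g + W'| ≤ ε`
    have htI : t ∈ Icc 0 T := Ioo_subset_Icc_self ht
    have huc : Continuous (u t) := (h.contDiff_velocity htI).continuous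
    have hu2 : ContDiff ℝ 2 (u t) := contDiff_infty.1 (h.contDiff_velocity htI) 2
    have b1 := hK₁ (u t) A huc (hA t htI) R hR1
    have b2 := hK₂ (u t) A huc (hA t htI) R hR1
    have b4 := hK₄ (u t) A hu2 (hA t htI) R hR1 x₀
    have key := fderiv_harmonicPart_eq_morrey h ht (hA t htI) hR0 x₀ a
    rw [key]
    dsimp only
    generalize (∫ y, ⟪u t y, (Δ (fun y => probeBump R (y - x₀))) y • a⟫) = A' at b1 ⊢
    generalize (∫ y, ⟪u t y, fderiv ℝ (fun y => probeBump R (y - x₀)) y (u t y) • a⟫) = B at b2 ⊢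
    generalize (∫ z, fderiv ℝ (probeBump R) z a * pressurePotential (u t) (x₀ - z)) = D' at b4 ⊢
    generalize (∫ y, ⟪timeDerivWithin (Icc 0 T) u t y, probeBump R (y - x₀) • a⟫) = C'
    have e : ν * A' + B - C' - D' + C' = ν * A' + B - D' := by ring
    rw [e]
    calc |ν * A' + B - D'| ≤ ν * |A'| + |B| + |D'| := by
          calc |ν * A' + B - D'| ≤ |ν * A' + B| + |D'| := abs_sub _ _
            _ ≤ |ν * A'| + |B| + |D'| := by gcongr; exact abs_add_le _ _
            _ = ν * |A'| + |B| + |D'| := by rw [abs_mul, abs_of_nonneg hν]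
      _ ≤ ν * (K₁ * (1 + A) * R⁻¹) + K₂ * A * R⁻¹ + K₄ * A * R⁻¹ := by
          gcongr
      _ ≤ ν * (K₁ * D * R⁻¹) + K₂ * D * R⁻¹ + K₄ * D * R⁻¹ := by
          rw [hD]
          gcongr
      _ = (ν * K₁ + K₂ + K₄) * D * R⁻¹ := by ring
      _ ≤ K * R⁻¹ := mul_le_mul_of_nonneg_right hK124le hRi
      _ ≤ ε := hKR

/-- **`h(t)` is constant in space at interior times on the Morrey class**:
`p(t, x) − Q[u(t)](x) = p(t, 0) − Q[u(t)](0)` for every `x` and `t ∈ (0, T)`.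
[cite: Tao2011, §4, proof of Lemma 4.1 (i)] -/
theorem pressure_sub_pressurePotential_eq_morrey (hν : 0 ≤ ν)
    (h : IsClassicalNSSolutionOn (Icc 0 T) ν 0 u p) {A : ℝ} (hA0 : 0 ≤ A)
    (hA : ∀ t ∈ Icc 0 T, ∀ (x : EuclideanSpace ℝ (Fin 3)) (r : ℝ), 1 ≤ r →
      ∫ y in ball x r, ‖u t y‖ ^ 2 ≤ A * r)
    {t : ℝ} (ht : t ∈ Ioo 0 T) (x : EuclideanSpace ℝ (Fin 3)) :
    p t x - pressurePotential (u t) x = p t 0 - pressurePotential (u t) 0 := by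
  have htI : t ∈ Icc 0 T := Ioo_subset_Icc_self ht
  have hu4 : ContDiff ℝ 4 (u t) := contDiff_infty.1 (h.contDiff_velocity htI) 4
  have hp1 : ContDiff ℝ 1 (p t) := contDiff_infty.1 (h.contDiff_pressure htI) 1
  have hQ : ContDiff ℝ 2 (pressurePotential (u t)) := contDiff_pressurePotential_morrey hu4 (hA t htI)
  have hdiff : Differentiable ℝ fun x => p t x - pressurePotential (u t) x :=
    (hp1.differentiable one_ne_zero).sub (hQ.differentiable two_ne_zero)
  have hzero : ∀ x, fderiv ℝ (fun x => p t x - pressurePotential (u t) x) x = 0 := fun x => by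
    ext a
    rw [fderiv_harmonicPart_eq_zero_morrey hν h hA0 hA x a t ht]
    rfl
  exact is_const_of_fderiv_eq_zero hdiff hzero x 0

end Summit.NavierStokesRegularity.NavierStokesRegularity.Theorems.SingularProfile
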